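import Mathlib
import Summits.CriticalPhenomena.PercolationContinuityZ3.Theorems.PercNearOneGluingNoHeavyLowerTailHypergeomSums
import Summits.CriticalPhenomena.PercolationContinuityZ3.Theorems.PercNearOneGluingNoHeavyLowerTailBandTwoTN
import HarnessLib

/-!
# TWO RAYS, the integer copy on or below B's ray (g34 THEOREM N3) in the kernel's hypergeometric vocabulary

Support file for the Sahi / Conjecture-P programme of route `PercNearOneGluingNoHeavy`
(`--supports stmt-CriticalPhenomena-4575`, prover prim-l12-p5 gen 43; proof notes `prim-l12-p5/PROOF-TWO-RAY-g34.md` §2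
(THEOREM N3) and `prim-l12-p5/PROOF-THREE-RAYS-g43.md` §1 (band form)).  No definitions, no named facts, no sorries.

For `Ψ = (1+p_Au+q_Av)(1+p_Bu+q_Bv)^θ` the `x`-Laplace matrix has, in the basis `y = 1 + c_B X`, the BIDIAGONAL rows
`a_n y^n + b_n y^{n-1}` with (c-contiguity, `u_n = λ^n Q_{m+1}(n)/n!`)
`a_n = m Q_m(n) + g_A n Q_{m+1}(n-1)`, `b_n = (n w_A/λ) Q_{m+1}(n-1)`, `Q_c = ₂F₁(-θ,-·;c;g_B)`, `m = s+1`,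
`w_A = b_A - g_Aλ_B` — so `b_n ≥ 0` exactly when the copy lies on or below `B`'s ray.  Then the kernel is a nonnegative
lower bidiagonal matrix times Pascal, hence totally nonnegative (`BandTwoTN.bidiag_minor_nonneg`, `choose_minor_nonneg`,
`TNKernel.mulLower_minor_nonneg`): the one-copy ("Type III with T = 1") companion of `BandTwoHyp.threeRay_below_tn`.
-/

namespace Summit.CriticalPhenomena.PercolationContinuityZ3.Theorems

namespace TwoRayBelow

open Finset Matrix BandTwoTN
open scoped Nat

section

variable (g : ℝ) (H : ℝ → ℝ → ℕ → ℝ)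
  (hH : ∀ a c r, H a c r = ∑ k ∈ range (r + 1), (r.choose k : ℝ) * (-g) ^ k *
    ((∏ i ∈ range k, (a + i)) / (∏ i ∈ range k, (c + i))))
include hH

/-- **THEOREM N3 (g34) in kernel form.**  For `m > 0`, `a ≤ m` (the application has `a = -θ ≤ 0`), `0 ≤ g < 1`,
`λ > 0`, `g_A ≥ 0`, `w ≥ 0`, the bidiagonal-times-Pascal kernel
`(m H(a,m,n) + g_A n H(a,m+1,n-1)) C(n,l) + (n w/λ) H(a,m+1,n-1) C(n-1,l)` is totally nonnegative. -/
theorem twoRay_below_tn (hg0 : 0 ≤ g) (hg1 : g < 1) (a m : ℝ) (hm : 0 < m) (ham : a ≤ m)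
    (lam : ℝ) (hlam : 0 < lam) (gA w : ℝ) (hgA : 0 ≤ gA) (hw : 0 ≤ w)
    {k : ℕ} (r c : Fin k → ℕ) (hr : StrictMono r) (hc : StrictMono c) :
    0 ≤ (Matrix.of fun i j =>
      (m * H a m (r i) + gA * (r i : ℝ) * H a (m + 1) (r i - 1)) * ((r i).choose (c j) : ℝ)
      + ((r i : ℝ) * w / lam * H a (m + 1) (r i - 1)) * (((r i) - 1).choose (c j) : ℝ)).det := by
  have hQ0 : ∀ n, 0 < H a m n := fun n => HypergeomCM.hyp_pos g H hH hg0 hg1 a n m hm ham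
  have hQp : ∀ n, 0 < H a (m + 1) n := fun n =>
    HypergeomCM.hyp_pos g H hH hg0 hg1 a n (m + 1) (by linarith) (by linarith)
  set d : ℕ → ℝ := fun n => m * H a m n + gA * (n : ℝ) * H a (m + 1) (n - 1) with hd
  set e : ℕ → ℝ := fun n => (n : ℝ) * w / lam * H a (m + 1) (n - 1) with he
  have hdpos : ∀ n, 0 < d n := fun n => by
    simp only [hd]
    have h1 : 0 < m * H a m n := mul_pos hm (hQ0 n)
    have h2 : 0 ≤ gA * (n : ℝ) * H a (m + 1) (n - 1) :=
      mul_nonneg (mul_nonneg hgA (Nat.cast_nonneg n)) (hQp _).le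
    linarith
  have henn : ∀ n, 0 ≤ e n := fun n => by
    simp only [he]
    exact mul_nonneg (div_nonneg (mul_nonneg (Nat.cast_nonneg n) hw) hlam.le) (hQp _).le
  have he0 : e 0 = 0 := by simp [he]
  have heq : (Matrix.of fun i j =>
      (m * H a m (r i) + gA * (r i : ℝ) * H a (m + 1) (r i - 1)) * ((r i).choose (c j) : ℝ)
      + ((r i : ℝ) * w / lam * H a (m + 1) (r i - 1)) * (((r i) - 1).choose (c j) : ℝ)) =
      Matrix.of fun i j => ∑ t ∈ range (r i + 1),
        (if t = r i then d (r i) else if t + 1 = r i then e (r i) else 0) * ((t.choose (c j) : ℕ) : ℝ) := by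
    ext i j
    rw [Matrix.of_apply, Matrix.of_apply, sum_bidiag d e (fun t => ((t.choose (c j) : ℕ) : ℝ)) he0 (r i)]
  rw [heq]
  set N := (univ.sup r) + (univ.sup c) + 1 with hN
  refine TNKernel.mulLower_minor_nonneg
    (fun n t => if t = n then d n else if t + 1 = n then e n else 0)
    (fun t l => ((t.choose l : ℕ) : ℝ)) N ?_ ?_ ?_ r c hr hc (fun i => ?_) (fun j => ?_)
  · intro k' r' c' hr' hc'
    exact bidiag_minor_nonneg d e hdpos henn r' c' hr' hc'
  · intro k' r' c' hr' hc' _ _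
    exact choose_minor_nonneg r' c' hr' hc'
  · intro n t hnt
    rw [if_neg (by omega), if_neg (by omega)]
  · have : r i ≤ univ.sup r := Finset.le_sup (f := r) (mem_univ i)
    omega
  · have : c j ≤ univ.sup c := Finset.le_sup (f := c) (mem_univ j)
    omega

end

end TwoRayBelow

end Summit.CriticalPhenomena.PercolationContinuityZ3.Theorems
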